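import Literature.Topology.FourManifolds.NovikovAdditivity
import Literature.Topology.FourManifolds.IntersectionLatticeProofs
import Literature.Topology.FourManifolds.InteriorConnected
import Literature.Topology.FourManifolds.HomotopySpheresSignatureConnectedSum
import Literature.AlgebraicTopology.SingularHomology.CohomologyOfPoint
import HarnessLib

/-!
# The signature under torus surgery and fibre sum (corollaries of Novikov additivity)

A. Akhmedov, B. D. Park, *Exotic smooth structures on small 4-manifolds with odd signatures*,
Invent. Math. 181 (2010) (arXiv:math/0701829), use without comment, in §2 ("the Euler
characteristic of `Y_n(m)` is `4n-4` and its signature is `0`", `Y_n(m)` being obtained from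
`Σ₂ × Σ_n` by `2n+4` torus surgeries), §4 ("`σ(Z') = σ(Z''(1/q, m/r)) = -1`", torus surgeries on
`T⁴ # ℂℙ²bar`) and in the proof of Lemma 8, §9 ("`σ(X₁(m)) = σ(Y₁(1,1)) + σ(Z''(1,m))`" for the
normal connected sum `X₁(m) = Y₁(1,1) #_ψ Z''(1,m)` along genus-2 surfaces of self-intersection
`0`), the two standard facts

* **the signature is invariant under torus surgery** (remove `T² × D²`, reglue it by any
  diffeomorphism of `T³`), and
* **the signature is additive under the (generalised) fibre sum** along a surface with trivial
  normal bundle, `σ(X₁ #_Σ X₂) = σ(X₁) + σ(X₂)` (R. Gompf, *A new construction of symplectic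
  manifolds*, Ann. of Math. 142 (1995), p. 535),

both of which are instances of **Novikov additivity** `σ(M ∪_∂ N) = σ(M) + σ(N)` (R. Kirby, *The
topology of 4-manifolds*, LNM 1374 (1989), Ch. II Thm. 5.3; the tree's
`BoundaryGluingData.signatureInDim_eq_add`, `NovikovAdditivity.lean`) together with the vanishing
of the (degenerate) intersection form of the piece `F × D²` (`F = T²`, resp. `F = Σ`): its closed
model `(F × D²)/(F × S¹) ≅ (F × ℝ²)⁺ ≅ Σ²(F₊)` has no non-zero cup products in positive degrees.

This file proves the two facts **abstractly**, for boundary gluings of null-cobordisms in the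
tree's sense (`BoundaryGluingData`, `NullCobordism`), the piece that is removed / along which one
glues being any compact piece `N` whose closed model `N̂ = N ∪ cone(∂N)` is *cup-trivial in the
middle degree* (`∀ a b ∈ Hᵏ(N̂; ℤ), a ⌣ b = 0`) — for `N = F × D²` this hypothesis is discharged by
`Literature.AlgebraicTopology.SingularHomology.OnePoint.cupProduct_eq_zero_of_homeomorph_prod`
from `int N ≅ F × ℝ²`:

* `IsRelFundamentalClass.eq_or_eq_neg` — on a path-connected compact manifold with boundary two
  relative fundamental classes over `ℤ` agree up to sign (Lefschetz duality in degree `0`,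
  `H⁰ ≅ ℤ`; Hatcher 2002, Lemma 3.27 / Thm. 3.43);
* `BoundaryGluingData.signatureInDim_eq_of_cupProduct_eq_zero` — **one-sided Novikov**: if `N̂` is
  cup-trivial then `σ(M ∪_φ N, μ) = τ(B_M)`, the signature of the closed-model form of `M` for the
  relative fundamental class induced by `μ`;
* `BoundaryGluingData.signatureInDim_eq_or_eq_neg_of_cupProduct_eq_zero`,
  `BoundaryGluingData.exists_signatureInDim_eq_of_cupProduct_eq_zero`, and the four-dimensional
  `BoundaryGluingData.natAbs_signature_eq_of_cupProduct_eq_zero`,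
  `BoundaryGluingData.exists_signature_eq_of_cupProduct_eq_zero` — **piece replacement / torus
  surgery**: `P = M ∪_φ N`, `P' = M ∪_φ' N'` with `N̂`, `N̂'` cup-trivial and `M` connected have
  `σ(P', μ') = ± σ(P, μ)`, and `P'` carries an orientation with `σ(P') = σ(P, μ)`;
* `BoundaryGluingData.exists_signs_signatureInDim_fibreSum`,
  `BoundaryGluingData.exists_signatureInDim_fibreSum_eq_add` and the four-dimensional
  `BoundaryGluingData.exists_signature_fibreSum_eq_add` — **fibre sum**: `Xᵢ = Mᵢ ∪ Nᵢ` with `N̂ᵢ`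
  cup-trivial and `Mᵢ` connected, `P = M₁ ∪_ψ M₂`: `σ(P, μ) = ± σ(X₁, μ₁) ± σ(X₂, μ₂)`, and for
  suitable orientations `σ(P) = σ(X₁) + σ(X₂)`.

Everything is proved; no definitions, no named facts.  The finite generation of `Hᵏ(Ŵ; ℤ)/T`
and `Hₖ(Ŵ; ℤ)` of the closed models, an instance hypothesis in `NovikovAdditivity.lean`, is
discharged by the tree's `NullCobordism.finite_freeCohomology_closedModel`,
`NullCobordism.finite_singularHomology_closedModel` (`HomotopySpheresSignatureConnectedSum.lean`),
so that no finiteness hypothesis remains.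

## References

* R. C. Kirby, *The topology of 4-manifolds*, LNM 1374, Springer 1989, Ch. II §5 Thm. 5.3.
  [Kirby1989]
* A. Akhmedov, B. D. Park, Invent. Math. 181 (2010) 577–603, §2, §4, §9 (proof of Lemma 8).
  [AkhmedovPark2010]
* R. E. Gompf, *A new construction of symplectic manifolds*, Ann. of Math. 142 (1995) 527–595,
  p. 535. [Gompf1995]
* A. Hatcher, *Algebraic Topology*, CUP 2002, §3.3 Lemma 3.27, Thm. 3.43, §3.2 Exercise 2.
  [HatcherAT2002]
-/

noncomputable section

open scoped Manifold ContDiff Topology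
open Set Function Filter CategoryTheory Limits
open Literature.AlgebraicTopology.SingularHomology

/-! ### The signature of the zero form -/

namespace LinearMap.BilinForm

/-- The zero form has signature `0` (`b⁺ = b⁻`, both being `sigPos 0`). [folklore] -/
theorem signature_zero {V : Type*} [AddCommGroup V] [Module ℤ V] :
    (0 : LinearMap.BilinForm ℤ V).signature = 0 := by
  simp only [signature]
  have h : (0 : LinearMap.BilinForm ℤ V).toQuadraticMap = 0 := rfl
  rw [h, sigNeg, neg_zero, sub_self]

end LinearMap.BilinForm

namespace Literature.Topology.FourManifolds

/-! ### Bilinear forms computing a cup pairing `([a], [b]) ↦ ⟨a ⌣ b, z⟩` on `Hᵏ/T` -/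

/-- **The cup pairing against a class `z ∈ Hₙ(Y; ℤ)` descends to cohomology mod torsion**: there
is a bilinear form `B` on `Hᵏ(Y; ℤ)/T` with `B [a] [b] = ⟨a ⌣ b, z⟩` (the `ℤ`-valued pairing
kills torsion in each variable; Hatcher 2002, §3.3 p. 250, Cor. 3.39; built with
`LinearMap.liftQ₂` exactly as the tree's `cupPairingModTorsion`). [cite: HatcherAT2002, §3.3 p. 250] -/
theorem exists_bilinForm_eq_kroneckerPairing_cupProduct {R : Type} [CommRing R] {Y : Type}
    [TopologicalSpace Y] {k n : ℕ} (h : k + k = n) (z : singularHomology R R Y n) :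
    ∃ B : LinearMap.BilinForm R (freeCohomology R Y k),
      ∀ a b, B (freeCohomology.mk a) (freeCohomology.mk b) =
        kroneckerPairing R R Y n (cupProduct h a b) z := by
  let B₀ : singularCohomology R R Y k →ₗ[R] singularCohomology R R Y k →ₗ[R] R :=
    (cupProduct h).compr₂ ((kroneckerPairing R R Y n).flip z)
  exact ⟨B₀.liftQ₂ _ _ (torsion_le_ker_bilinear B₀) (torsion_le_ker_bilinear_flip B₀),
    fun a b => rfl⟩

/-- Two bilinear forms on `Hᵏ(Y; ℤ)/T` with the same values on classes `[a], [b]` are equal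
(`Hᵏ → Hᵏ/T` is onto). [folklore] -/
theorem bilinForm_freeCohomology_ext {Y : Type} [TopologicalSpace Y] {k : ℕ}
    {B B' : LinearMap.BilinForm ℤ (freeCohomology ℤ Y k)}
    (hBB' : ∀ a b, B (freeCohomology.mk a) (freeCohomology.mk b) =
      B' (freeCohomology.mk a) (freeCohomology.mk b)) : B = B' := by
  refine LinearMap.ext fun x => LinearMap.ext fun y => ?_
  induction x using freeCohomology.induction_on with
  | h a =>
    induction y using freeCohomology.induction_on with
    | h b => exact hBB' a b

/-- If `B` computes `⟨a ⌣ b, z⟩` then `-B` computes `⟨a ⌣ b, -z⟩` (reversing the orientation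
class negates the form; Kirby 1989, Ch. II §5 p. 27). [cite: Kirby1989, Ch. II §5 p. 27] -/
theorem neg_bilinForm_eq_kroneckerPairing_cupProduct_neg {Y : Type} [TopologicalSpace Y]
    {k n : ℕ} (h : k + k = n) (z : singularHomology ℤ ℤ Y n)
    {B : LinearMap.BilinForm ℤ (freeCohomology ℤ Y k)}
    (hB : ∀ a b, B (freeCohomology.mk a) (freeCohomology.mk b) =
      kroneckerPairing ℤ ℤ Y n (cupProduct h a b) z) :
    ∀ a b, (-B) (freeCohomology.mk a) (freeCohomology.mk b) =
      kroneckerPairing ℤ ℤ Y n (cupProduct h a b) (-z) := by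
  intro a b
  rw [LinearMap.neg_apply, LinearMap.neg_apply, hB, map_neg]

/-! ### Relative fundamental classes of a connected manifold agree up to sign -/

/-- **On a path-connected compact manifold with boundary, two relative fundamental classes over
`ℤ` agree up to sign** (Hatcher 2002, §3.3: Lemma 3.27 / Thm. 3.26 for closed manifolds — "if `M`
is connected there are exactly two fundamental classes `±[M]`" — and p. 253–254, Thm. 3.43 for
the relative case).  Proof: by Lefschetz duality in degree `0`
(`bijective_relCapProduct_of_isRelFundamentalClass_holds`) and `H⁰(W; ℤ) ≅ ℤ`
(`singularCohomologyZeroEquiv`), `Hₙ₊₁(W, ∂W; ℤ)` is infinite cyclic, so the functional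
"local value at an interior point `x`" — which is `1` on `w` — is injective; its value on `w'` is
`±1` (the two identifications `Hₙ₊₁(W | x) ≅ ℤ` differ by a sign), whence `w' = ±w`.
[cite: HatcherAT2002, §3.3 Lemma 3.27 and Thm. 3.43] -/
theorem _root_.Literature.AlgebraicTopology.SingularHomology.IsRelFundamentalClass.eq_or_eq_neg
    {n : ℕ} {W : Type} [TopologicalSpace W] [T2Space W] [CompactSpace W]
    [ChartedSpace (EuclideanHalfSpace (n + 1)) W] [PathConnectedSpace W]
    {w w' : relativeSingularHomology ℤ ℤ W ((𝓡∂ (n + 1)).boundary W) (n + 1)}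
    (hw : IsRelFundamentalClass ℤ ((𝓡∂ (n + 1)).boundary W) w)
    (hw' : IsRelFundamentalClass ℤ ((𝓡∂ (n + 1)).boundary W) w')
    (hint : ∃ x : W, x ∉ (𝓡∂ (n + 1)).boundary W) :
    w' = w ∨ w' = -w := by
  obtain ⟨x₀, hx₀⟩ := hint
  set x : ↥((𝓡∂ (n + 1)).boundary W)ᶜ := ⟨x₀, hx₀⟩ with hx
  obtain ⟨e, he⟩ := hw x
  obtain ⟨e', he'⟩ := hw' x
  -- Lefschetz duality in degree `0`
  have hL := bijective_relCapProduct_of_isRelFundamentalClass_holds n W w hw (zero_add (n + 1))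
  unfold bijective_relCapProduct_of_isRelFundamentalClass at hL
  -- the functional "local value at `x`"
  let lam : relativeSingularHomology ℤ ℤ W ((𝓡∂ (n + 1)).boundary W) (n + 1) →ₗ[ℤ] ℤ :=
    e.toLinearMap ∘ₗ
      (relativeSingularHomology.toLocal ℤ ℤ ((𝓡∂ (n + 1)).boundary W) x (n + 1)).hom
  have hlam : ∀ z, lam z =
      e (relativeSingularHomology.toLocal ℤ ℤ ((𝓡∂ (n + 1)).boundary W) x (n + 1) z) :=
    fun z => rfl
  have hw1 : lam w = 1 := he
  -- `H⁰(W; ℤ) ≅ ℤ` and the composite `T : ℤ → ℤ`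
  let e0 : singularCohomology ℤ ℤ W 0 ≃ₗ[ℤ] ℤ := singularCohomologyZeroEquiv ℤ ℤ W
  let T : ℤ →+ ℤ := AddMonoidHom.mk'
    (fun r => lam (relCapProduct (M := ℤ) ((𝓡∂ (n + 1)).boundary W) (zero_add (n + 1))
      (e0.symm r) w))
    (fun r s => by simp only [map_add, LinearMap.add_apply])
  have hT : ∀ r : ℤ, T r =
      lam (relCapProduct (M := ℤ) ((𝓡∂ (n + 1)).boundary W) (zero_add (n + 1)) (e0.symm r) w) :=
    fun r => rfl
  have hTmul : ∀ r : ℤ, T r = r * T 1 := fun r => by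
    rw [AddMonoidHom.apply_int, smul_eq_mul]
  obtain ⟨a, ha⟩ := hL.2 w
  have ha' : relCapProduct (M := ℤ) ((𝓡∂ (n + 1)).boundary W) (zero_add (n + 1)) a w = w := ha
  have hT1 : T 1 ≠ 0 := by
    intro h0
    have h1 : T (e0 a) = 1 := by rw [hT, LinearEquiv.symm_apply_apply, ha', hw1]
    rw [hTmul, h0, mul_zero] at h1
    exact zero_ne_one h1
  -- `lam` is injective
  have hinj : Function.Injective lam := by
    intro z₁ z₂ h12
    obtain ⟨a₁, rfl⟩ := hL.2 z₁
    obtain ⟨a₂, rfl⟩ := hL.2 z₂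
    obtain ⟨r₁, rfl⟩ := e0.symm.surjective a₁
    obtain ⟨r₂, rfl⟩ := e0.symm.surjective a₂
    have h12' : T r₁ = T r₂ := h12
    rw [hTmul r₁, hTmul r₂] at h12'
    have hr : r₁ = r₂ := mul_right_cancel₀ hT1 h12'
    rw [hr]
  -- compare the local values of `w` and `w'`
  rcases Int.linearEquiv_eq_or_eq_neg e e' with hee | hee
  · left
    apply hinj
    rw [hw1, hlam, ← hee]
    exact he'
  · right
    apply hinj
    rw [map_neg, hw1, hlam]
    have h2 := hee (relativeSingularHomology.toLocal ℤ ℤ ((𝓡∂ (n + 1)).boundary W) x (n + 1) w')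
    rw [he'] at h2
    linarith

namespace NullCobordism

/-- For a null-cobordism `W` of a nonempty closed manifold (so `W ≠ ∅` has nonempty interior) with
connected `W`, two relative fundamental classes of `(W, ∂W)` over `ℤ` agree up to sign.
[cite: HatcherAT2002, §3.3 Lemma 3.27 and Thm. 3.43] -/
theorem isRelFundamentalClass_eq_or_eq_neg {n : ℕ} {S : Type} [TopologicalSpace S]
    [ChartedSpace (EuclideanSpace ℝ (Fin n)) S] [Nonempty S] (c : NullCobordism n S)
    [ConnectedSpace c.W]
    {w w' : relativeSingularHomology ℤ ℤ c.W ((𝓡∂ (n + 1)).boundary c.W) (n + 1)}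
    (hw : IsRelFundamentalClass ℤ ((𝓡∂ (n + 1)).boundary c.W) w)
    (hw' : IsRelFundamentalClass ℤ ((𝓡∂ (n + 1)).boundary c.W) w') :
    w' = w ∨ w' = -w := by
  haveI : LocallyPathConnectedSpace c.W :=
    ChartedSpace.locallyPathConnectedSpace (EuclideanHalfSpace (n + 1)) c.W
  haveI : PathConnectedSpace c.W := pathConnectedSpace_iff_connectedSpace.mpr ‹_›
  haveI : Nonempty c.W := ⟨c.incl (Classical.arbitrary S)⟩
  obtain ⟨x, hx⟩ := interior_nonempty (I := 𝓡∂ (n + 1)) (M := c.W)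
  exact hw.eq_or_eq_neg hw' ⟨x, c.not_mem_boundary_of_mem_interior hx⟩

/-- **Closed-model forms for two relative fundamental classes have signatures differing by the
sign relating the classes**: on a connected null-cobordism, if `B` computes `⟨a ⌣ b, c_w⟩` for a
relative fundamental class `w`, then for any other relative fundamental class `v` (`= ± w`) there
is a form `B'` computing `⟨a ⌣ b, c_v⟩` with `τ(B') = ε τ(B)`, `ε = ±1`
(Kirby 1989, Ch. II §5 p. 27: reversing the orientation reverses the sign of the index).
[cite: Kirby1989, Ch. II §5 p. 27] -/
theorem exists_sign_bilinForm_of_isRelFundamentalClass {m : ℕ} {S : Type} [TopologicalSpace S]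
    [ChartedSpace (EuclideanSpace ℝ (Fin (m + 1))) S] [Nonempty S] (c : NullCobordism (m + 1) S)
    [ConnectedSpace c.W] {k : ℕ} (h : k + k = m + 1 + 1)
    {w v : relativeSingularHomology ℤ ℤ c.W ((𝓡∂ (m + 1 + 1)).boundary c.W) (m + 1 + 1)}
    (hw : IsRelFundamentalClass ℤ ((𝓡∂ (m + 1 + 1)).boundary c.W) w)
    (hv : IsRelFundamentalClass ℤ ((𝓡∂ (m + 1 + 1)).boundary c.W) v)
    {B : LinearMap.BilinForm ℤ (freeCohomology ℤ (ClosedModel (m + 1) c.W) k)}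
    (hB : ∀ a b, B (freeCohomology.mk a) (freeCohomology.mk b) =
      kroneckerPairing ℤ ℤ (ClosedModel (m + 1) c.W) (m + 1 + 1) (cupProduct h a b)
        (c.closedModelClass ℤ ℤ (Nat.le_add_left 1 m) w)) :
    ∃ (ε : ℤ) (B' : LinearMap.BilinForm ℤ (freeCohomology ℤ (ClosedModel (m + 1) c.W) k)),
      (ε = 1 ∨ ε = -1) ∧
      (∀ a b, B' (freeCohomology.mk a) (freeCohomology.mk b) =
        kroneckerPairing ℤ ℤ (ClosedModel (m + 1) c.W) (m + 1 + 1) (cupProduct h a b)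
          (c.closedModelClass ℤ ℤ (Nat.le_add_left 1 m) v)) ∧
      B'.signature = ε * B.signature := by
  rcases c.isRelFundamentalClass_eq_or_eq_neg hw hv with rfl | rfl
  · exact ⟨1, B, Or.inl rfl, hB, by rw [one_mul]⟩
  · refine ⟨-1, -B, Or.inr rfl, fun a b => ?_, ?_⟩
    · rw [neg_bilinForm_eq_kroneckerPairing_cupProduct_neg h _ hB a b, c.closedModelClass_neg]
    · rw [LinearMap.BilinForm.signature_neg, neg_one_mul]

end NullCobordism

/-! ### One-sided Novikov additivity: a cup-trivial piece does not contribute -/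

namespace BoundaryGluingData

variable {m : ℕ}
variable {S : Type} [TopologicalSpace S] [ChartedSpace (EuclideanSpace ℝ (Fin (m + 1))) S]
  [IsManifold (𝓡 (m + 1)) ∞ S] [CompactSpace S] [Nonempty S] [T2Space S]
variable {S' : Type} [TopologicalSpace S'] [ChartedSpace (EuclideanSpace ℝ (Fin (m + 1))) S']
  [IsManifold (𝓡 (m + 1)) ∞ S'] [CompactSpace S'] [Nonempty S'] [T2Space S']
variable {cM : NullCobordism (m + 1) S} {cN : NullCobordism (m + 1) S'} {φ : S ≃ S'}
variable {P : Type} [TopologicalSpace P] [T2Space P] [CompactSpace P]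
  [ChartedSpace (EuclideanSpace ℝ (Fin (m + 1 + 1))) P] [IsManifold (𝓡 (m + 1 + 1)) ∞ P]
variable (G : BoundaryGluingData cM.boundaryData cN.boundaryData φ P)

/-- **One-sided Novikov additivity.** For a closed gluing `P = M ∪_φ N` oriented by `μ`, with
`wM` the relative class of `M` induced by `μ` and `B_M` a form computing the closed-model cup form
`⟨a ⌣ b, c_{wM}⟩` of `M`: if the closed model `N̂` of the other piece is cup-trivial in the middle
degree (`a ⌣ b = 0` for all `a, b ∈ Hᵏ(N̂; ℤ)` — e.g. `N = T² × D²`, `Σ × D²`), then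
`σ(P, μ) = τ(B_M)` (Kirby 1989, Ch. II Thm. 5.3 with index `N` = `0`).
[cite: Kirby1989, Ch. II §5, Thm. 5.3] -/
theorem signatureInDim_eq_of_cupProduct_eq_zero (μ : HomologicalOrientation ℤ P (m + 1 + 1))
    (wM : relativeSingularHomology ℤ ℤ cM.W ((𝓡∂ (m + 1 + 1)).boundary cM.W) (m + 1 + 1))
    (hwM : relativeSingularHomology.map ℤ ℤ (⟨G.jA, G.continuous_jA⟩ : C(cM.W, P))
        G.mapsTo_jA_boundary (m + 1 + 1) wM =
      relativeSingularHomology.ofAbsolute ℤ ℤ P (range G.jB) (m + 1 + 1) μ.fundamentalClass)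
    {k : ℕ} (h : k + k = m + 1 + 1) (hk : Even k)
    (BM : LinearMap.BilinForm ℤ (freeCohomology ℤ (ClosedModel (m + 1) cM.W) k))
    (hBM : ∀ a b, BM (freeCohomology.mk a) (freeCohomology.mk b) =
      kroneckerPairing ℤ ℤ (ClosedModel (m + 1) cM.W) (m + 1 + 1) (cupProduct h a b)
        (cM.closedModelClass ℤ ℤ (Nat.le_add_left 1 m) wM))
    (hN : ∀ a b : singularCohomology ℤ ℤ (ClosedModel (m + 1) cN.W) k, cupProduct h a b = 0) :
    μ.signatureInDim h = BM.signature := by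
  obtain ⟨κM⟩ := BoundaryData.nonempty_collar_of_compactSpace m cM.W cM.boundaryData
  obtain ⟨κN⟩ := BoundaryData.nonempty_collar_of_compactSpace m cN.W cN.boundaryData
  haveI := cM.finite_singularHomology_closedModel κM k
  haveI := cN.finite_singularHomology_closedModel κN k
  haveI := cM.finite_freeCohomology_closedModel κM k
  haveI := cN.finite_freeCohomology_closedModel κN k
  obtain ⟨wN, hwN, -⟩ := G.existsUnique_map_jB_eq_ofAbsolute ℤ ℤ (m + 1 + 1) μ.fundamentalClass
  have key := G.signatureInDim_eq_add μ wM wN hwM hwN h hk BM hBM 0 (fun a b => by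
    rw [hN a b, map_zero, LinearMap.zero_apply, LinearMap.zero_apply, LinearMap.zero_apply])
  rw [key, LinearMap.BilinForm.signature_zero, add_zero]

/-! ### Piece replacement (torus surgery): `σ(M ∪ N') = ± σ(M ∪ N)` -/

variable {S'' : Type} [TopologicalSpace S''] [ChartedSpace (EuclideanSpace ℝ (Fin (m + 1))) S'']
  [IsManifold (𝓡 (m + 1)) ∞ S''] [CompactSpace S''] [Nonempty S''] [T2Space S'']
variable {cN' : NullCobordism (m + 1) S''} {φ' : S ≃ S''}
variable {P' : Type} [TopologicalSpace P'] [T2Space P'] [CompactSpace P']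
  [ChartedSpace (EuclideanSpace ℝ (Fin (m + 1 + 1))) P'] [IsManifold (𝓡 (m + 1 + 1)) ∞ P']
include G in
/-- **The signature under replacement of a cup-trivial piece** (the mechanism behind "torus
surgery preserves the signature", as used in Akhmedov–Park 2010, §2 and §4, and behind Gompf's
fibre-sum formula): if `P = M ∪_φ N` and `P' = M ∪_φ' N'` are closed gluings of the SAME connected
piece `M` with pieces `N`, `N'` whose closed models are cup-trivial in the middle degree (for a
torus surgery `N = N' = T² × D²`, reglued by a different diffeomorphism of `T³`), then for all
`ℤ`-orientations `σ(P', μ') = ± σ(P, μ)`.  Proof: by one-sided Novikov additivity both signatures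
are closed-model signatures `τ(B_M^{w})`, `τ(B_M^{w'})` of `M` for the relative fundamental classes
`w`, `w'` induced by `μ`, `μ'`; `M` being connected, `w' = ± w`, and `B_M^{-w} = -B_M^{w}`.
[cite: Kirby1989, Ch. II §5, Thm. 5.3; AkhmedovPark2010, §4] -/
theorem signatureInDim_eq_or_eq_neg_of_cupProduct_eq_zero
    (G' : BoundaryGluingData cM.boundaryData cN'.boundaryData φ' P') [ConnectedSpace cM.W]
    {k : ℕ} (h : k + k = m + 1 + 1) (hk : Even k)
    (hN : ∀ a b : singularCohomology ℤ ℤ (ClosedModel (m + 1) cN.W) k, cupProduct h a b = 0)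
    (hN' : ∀ a b : singularCohomology ℤ ℤ (ClosedModel (m + 1) cN'.W) k, cupProduct h a b = 0)
    (μ : HomologicalOrientation ℤ P (m + 1 + 1)) (μ' : HomologicalOrientation ℤ P' (m + 1 + 1)) :
    μ'.signatureInDim h = μ.signatureInDim h ∨ μ'.signatureInDim h = -μ.signatureInDim h := by
  have hn : 1 ≤ m + 1 := Nat.le_add_left 1 m
  -- the relative classes of `M` induced by `μ` (via `G`) and by `μ'` (via `G'`)
  obtain ⟨w, hw, -⟩ := G.symm.existsUnique_map_jB_eq_ofAbsolute ℤ ℤ (m + 1 + 1) μ.fundamentalClass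
  obtain ⟨w', hw', -⟩ :=
    G'.symm.existsUnique_map_jB_eq_ofAbsolute ℤ ℤ (m + 1 + 1) μ'.fundamentalClass
  have hwf : IsRelFundamentalClass ℤ ((𝓡∂ (m + 1 + 1)).boundary cM.W) w :=
    G.symm.isRelFundamentalClass_of_map_jB_eq μ hw
  have hwf' : IsRelFundamentalClass ℤ ((𝓡∂ (m + 1 + 1)).boundary cM.W) w' :=
    G'.symm.isRelFundamentalClass_of_map_jB_eq μ' hw'
  -- a form for `w`
  obtain ⟨B, hB⟩ := exists_bilinForm_eq_kroneckerPairing_cupProduct h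
    (cM.closedModelClass ℤ ℤ hn w)
  have hσ : μ.signatureInDim h = B.signature :=
    G.signatureInDim_eq_of_cupProduct_eq_zero μ w hw h hk B hB hN
  rcases cM.isRelFundamentalClass_eq_or_eq_neg hwf hwf' with hww | hww <;> rw [hww] at hw'
  · exact Or.inl ((G'.signatureInDim_eq_of_cupProduct_eq_zero μ' w hw' h hk B hB hN').trans
      hσ.symm)
  · right
    have hB' := neg_bilinForm_eq_kroneckerPairing_cupProduct_neg h (cM.closedModelClass ℤ ℤ hn w) hB
    have hσ' : μ'.signatureInDim h = (-B).signature :=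
      G'.signatureInDim_eq_of_cupProduct_eq_zero μ' (-w) hw' h hk (-B)
        (fun a b => by rw [hB' a b, cM.closedModelClass_neg]) hN'
    rw [hσ', LinearMap.BilinForm.signature_neg, hσ]

include G in
/-- **Piece replacement preserves the signature up to orientation**: under the hypotheses of
`signatureInDim_eq_or_eq_neg_of_cupProduct_eq_zero`, `P'` carries a `ℤ`-orientation `μ''` with
`σ(P', μ'') = σ(P, μ)` (take `μ'' = ± μ'`, `σ(P', -μ') = -σ(P', μ')`).  In particular a torus
surgery on a closed oriented `4`-manifold does not change the signature for the appropriate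
orientation of the result (Akhmedov–Park 2010, §2: "the signature [of `Y_n(m)`] is `0`"; §4:
"`σ(Z') = σ(Z''(1/q, m/r)) = -1`"). [cite: AkhmedovPark2010, §2 and §4; Kirby1989, Ch. II §5, Thm. 5.3] -/
theorem exists_signatureInDim_eq_of_cupProduct_eq_zero
    (G' : BoundaryGluingData cM.boundaryData cN'.boundaryData φ' P') [ConnectedSpace cM.W]
    {k : ℕ} (h : k + k = m + 1 + 1) (hk : Even k)
    (hN : ∀ a b : singularCohomology ℤ ℤ (ClosedModel (m + 1) cN.W) k, cupProduct h a b = 0)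
    (hN' : ∀ a b : singularCohomology ℤ ℤ (ClosedModel (m + 1) cN'.W) k, cupProduct h a b = 0)
    (μ : HomologicalOrientation ℤ P (m + 1 + 1)) (μ' : HomologicalOrientation ℤ P' (m + 1 + 1)) :
    ∃ μ'' : HomologicalOrientation ℤ P' (m + 1 + 1), μ''.signatureInDim h = μ.signatureInDim h := by
  rcases G.signatureInDim_eq_or_eq_neg_of_cupProduct_eq_zero G' h hk hN hN' μ μ' with h1 | h1
  · exact ⟨μ', h1⟩
  · refine ⟨-μ', ?_⟩
    rw [HomologicalOrientation.signatureInDim_def, signature_intersectionForm_neg_holds h μ',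
      ← HomologicalOrientation.signatureInDim_def, h1, neg_neg]

/-! ### Fibre sums: `σ(M₁ ∪_ψ M₂) = ± σ(M₁ ∪ N₁) ± σ(M₂ ∪ N₂)` for cup-trivial `N̂₁`, `N̂₂` -/

/-- **The signature of a (generalised) fibre sum, up to signs.**  Let `X₁ = M₁ ∪_{φ₁} N₁` and
`X₂ = M₂ ∪_{φ₂} N₂` be closed gluings whose pieces `N₁`, `N₂` have closed models cup-trivial in
the middle degree (for the fibre sum along a codimension-two submanifold `F` with trivial normal
bundle: `Nᵢ = F × D² ⊇ F`, `Mᵢ = Xᵢ ∖ ν°F`), with `M₁`, `M₂` connected, and let `P = M₁ ∪_ψ M₂`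
be any closed gluing of the two complements.  Then for all `ℤ`-orientations
`σ(P, μ) = ε₁ σ(X₁, μ₁) + ε₂ σ(X₂, μ₂)` with `εᵢ = ±1` (Gompf 1995, p. 535:
"`σ(M₁ #_ψ M₂) = σ(M₁) + σ(M₂)`"; Akhmedov–Park 2010, proof of Lemma 8:
"`σ(X₁(m)) = σ(Y₁(1,1)) + σ(Z''(1,m))`").  Proof: Novikov additivity for `P` and one-sided
Novikov additivity for `X₁`, `X₂` express all three signatures through closed-model signatures of
`M₁`, `M₂`, for relative fundamental classes that agree up to sign.
[cite: Gompf1995, p. 535; Kirby1989, Ch. II §5, Thm. 5.3; AkhmedovPark2010, §9 proof of Lemma 8] -/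
theorem exists_signs_signatureInDim_fibreSum
    {S₁ : Type} [TopologicalSpace S₁] [ChartedSpace (EuclideanSpace ℝ (Fin (m + 1))) S₁]
    [IsManifold (𝓡 (m + 1)) ∞ S₁] [CompactSpace S₁] [Nonempty S₁] [T2Space S₁]
    {S₁' : Type} [TopologicalSpace S₁'] [ChartedSpace (EuclideanSpace ℝ (Fin (m + 1))) S₁']
    [IsManifold (𝓡 (m + 1)) ∞ S₁'] [CompactSpace S₁'] [Nonempty S₁'] [T2Space S₁']
    {S₂ : Type} [TopologicalSpace S₂] [ChartedSpace (EuclideanSpace ℝ (Fin (m + 1))) S₂]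
    [IsManifold (𝓡 (m + 1)) ∞ S₂] [CompactSpace S₂] [Nonempty S₂] [T2Space S₂]
    {S₂' : Type} [TopologicalSpace S₂'] [ChartedSpace (EuclideanSpace ℝ (Fin (m + 1))) S₂']
    [IsManifold (𝓡 (m + 1)) ∞ S₂'] [CompactSpace S₂'] [Nonempty S₂'] [T2Space S₂']
    {cM₁ : NullCobordism (m + 1) S₁} {cN₁ : NullCobordism (m + 1) S₁'}
    {cM₂ : NullCobordism (m + 1) S₂} {cN₂ : NullCobordism (m + 1) S₂'}
    {φ₁ : S₁ ≃ S₁'} {φ₂ : S₂ ≃ S₂'} {ψ : S₁ ≃ S₂}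
    {X₁ : Type} [TopologicalSpace X₁] [T2Space X₁] [CompactSpace X₁]
    [ChartedSpace (EuclideanSpace ℝ (Fin (m + 1 + 1))) X₁] [IsManifold (𝓡 (m + 1 + 1)) ∞ X₁]
    {X₂ : Type} [TopologicalSpace X₂] [T2Space X₂] [CompactSpace X₂]
    [ChartedSpace (EuclideanSpace ℝ (Fin (m + 1 + 1))) X₂] [IsManifold (𝓡 (m + 1 + 1)) ∞ X₂]
    {P : Type} [TopologicalSpace P] [T2Space P] [CompactSpace P]
    [ChartedSpace (EuclideanSpace ℝ (Fin (m + 1 + 1))) P] [IsManifold (𝓡 (m + 1 + 1)) ∞ P]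
    (G₁ : BoundaryGluingData cM₁.boundaryData cN₁.boundaryData φ₁ X₁)
    (G₂ : BoundaryGluingData cM₂.boundaryData cN₂.boundaryData φ₂ X₂)
    (G : BoundaryGluingData cM₁.boundaryData cM₂.boundaryData ψ P)
    [ConnectedSpace cM₁.W] [ConnectedSpace cM₂.W]
    {k : ℕ} (h : k + k = m + 1 + 1) (hk : Even k)
    (hN₁ : ∀ a b : singularCohomology ℤ ℤ (ClosedModel (m + 1) cN₁.W) k, cupProduct h a b = 0)
    (hN₂ : ∀ a b : singularCohomology ℤ ℤ (ClosedModel (m + 1) cN₂.W) k, cupProduct h a b = 0)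
    (μ₁ : HomologicalOrientation ℤ X₁ (m + 1 + 1)) (μ₂ : HomologicalOrientation ℤ X₂ (m + 1 + 1))
    (μ : HomologicalOrientation ℤ P (m + 1 + 1)) :
    ∃ ε₁ ε₂ : ℤ, (ε₁ = 1 ∨ ε₁ = -1) ∧ (ε₂ = 1 ∨ ε₂ = -1) ∧
      μ.signatureInDim h = ε₁ * μ₁.signatureInDim h + ε₂ * μ₂.signatureInDim h := by
  have hn : 1 ≤ m + 1 := Nat.le_add_left 1 m
  -- `X₁`: `σ(X₁, μ₁) = τ(B₁)`
  obtain ⟨w₁, hw₁, -⟩ :=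
    G₁.symm.existsUnique_map_jB_eq_ofAbsolute ℤ ℤ (m + 1 + 1) μ₁.fundamentalClass
  have hw₁f : IsRelFundamentalClass ℤ ((𝓡∂ (m + 1 + 1)).boundary cM₁.W) w₁ :=
    G₁.symm.isRelFundamentalClass_of_map_jB_eq μ₁ hw₁
  obtain ⟨B₁, hB₁⟩ := exists_bilinForm_eq_kroneckerPairing_cupProduct h
    (cM₁.closedModelClass ℤ ℤ hn w₁)
  have hσ₁ : μ₁.signatureInDim h = B₁.signature :=
    G₁.signatureInDim_eq_of_cupProduct_eq_zero μ₁ w₁ hw₁ h hk B₁ hB₁ hN₁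
  -- `X₂`: `σ(X₂, μ₂) = τ(B₂)`
  obtain ⟨w₂, hw₂, -⟩ :=
    G₂.symm.existsUnique_map_jB_eq_ofAbsolute ℤ ℤ (m + 1 + 1) μ₂.fundamentalClass
  have hw₂f : IsRelFundamentalClass ℤ ((𝓡∂ (m + 1 + 1)).boundary cM₂.W) w₂ :=
    G₂.symm.isRelFundamentalClass_of_map_jB_eq μ₂ hw₂
  obtain ⟨B₂, hB₂⟩ := exists_bilinForm_eq_kroneckerPairing_cupProduct h
    (cM₂.closedModelClass ℤ ℤ hn w₂)
  have hσ₂ : μ₂.signatureInDim h = B₂.signature :=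
    G₂.signatureInDim_eq_of_cupProduct_eq_zero μ₂ w₂ hw₂ h hk B₂ hB₂ hN₂
  -- `P`: Novikov additivity for the classes `v₁`, `v₂` induced by `μ`
  obtain ⟨v₁, hv₁, -⟩ := G.symm.existsUnique_map_jB_eq_ofAbsolute ℤ ℤ (m + 1 + 1) μ.fundamentalClass
  obtain ⟨v₂, hv₂, -⟩ := G.existsUnique_map_jB_eq_ofAbsolute ℤ ℤ (m + 1 + 1) μ.fundamentalClass
  have hv₁f : IsRelFundamentalClass ℤ ((𝓡∂ (m + 1 + 1)).boundary cM₁.W) v₁ :=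
    G.symm.isRelFundamentalClass_of_map_jB_eq μ hv₁
  have hv₂f : IsRelFundamentalClass ℤ ((𝓡∂ (m + 1 + 1)).boundary cM₂.W) v₂ :=
    G.isRelFundamentalClass_of_map_jB_eq μ hv₂
  obtain ⟨ε₁, B₁', hε₁, hB₁', hs₁⟩ :=
    cM₁.exists_sign_bilinForm_of_isRelFundamentalClass h hw₁f hv₁f hB₁
  obtain ⟨ε₂, B₂', hε₂, hB₂', hs₂⟩ :=
    cM₂.exists_sign_bilinForm_of_isRelFundamentalClass h hw₂f hv₂f hB₂
  refine ⟨ε₁, ε₂, hε₁, hε₂, ?_⟩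
  obtain ⟨κ₁⟩ := BoundaryData.nonempty_collar_of_compactSpace m cM₁.W cM₁.boundaryData
  obtain ⟨κ₂⟩ := BoundaryData.nonempty_collar_of_compactSpace m cM₂.W cM₂.boundaryData
  haveI := cM₁.finite_singularHomology_closedModel κ₁ k
  haveI := cM₂.finite_singularHomology_closedModel κ₂ k
  haveI := cM₁.finite_freeCohomology_closedModel κ₁ k
  haveI := cM₂.finite_freeCohomology_closedModel κ₂ k
  rw [G.signatureInDim_eq_add μ v₁ v₂ hv₁ hv₂ h hk B₁' hB₁' B₂' hB₂', hs₁, hs₂, hσ₁, hσ₂]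

/-- **The signature of a fibre sum is additive for suitable orientations**: under the hypotheses
of `exists_signs_signatureInDim_fibreSum` there are `ℤ`-orientations `μ₁'` of `X₁` and `μ₂'` of
`X₂` (namely `± μ₁`, `± μ₂`) with `σ(P, μ) = σ(X₁, μ₁') + σ(X₂, μ₂')` (Gompf 1995, p. 535;
Akhmedov–Park 2010, proof of Lemma 8). [cite: Gompf1995, p. 535; AkhmedovPark2010, §9 proof of Lemma 8] -/
theorem exists_signatureInDim_fibreSum_eq_add
    {S₁ : Type} [TopologicalSpace S₁] [ChartedSpace (EuclideanSpace ℝ (Fin (m + 1))) S₁]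
    [IsManifold (𝓡 (m + 1)) ∞ S₁] [CompactSpace S₁] [Nonempty S₁] [T2Space S₁]
    {S₁' : Type} [TopologicalSpace S₁'] [ChartedSpace (EuclideanSpace ℝ (Fin (m + 1))) S₁']
    [IsManifold (𝓡 (m + 1)) ∞ S₁'] [CompactSpace S₁'] [Nonempty S₁'] [T2Space S₁']
    {S₂ : Type} [TopologicalSpace S₂] [ChartedSpace (EuclideanSpace ℝ (Fin (m + 1))) S₂]
    [IsManifold (𝓡 (m + 1)) ∞ S₂] [CompactSpace S₂] [Nonempty S₂] [T2Space S₂]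
    {S₂' : Type} [TopologicalSpace S₂'] [ChartedSpace (EuclideanSpace ℝ (Fin (m + 1))) S₂']
    [IsManifold (𝓡 (m + 1)) ∞ S₂'] [CompactSpace S₂'] [Nonempty S₂'] [T2Space S₂']
    {cM₁ : NullCobordism (m + 1) S₁} {cN₁ : NullCobordism (m + 1) S₁'}
    {cM₂ : NullCobordism (m + 1) S₂} {cN₂ : NullCobordism (m + 1) S₂'}
    {φ₁ : S₁ ≃ S₁'} {φ₂ : S₂ ≃ S₂'} {ψ : S₁ ≃ S₂}
    {X₁ : Type} [TopologicalSpace X₁] [T2Space X₁] [CompactSpace X₁]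
    [ChartedSpace (EuclideanSpace ℝ (Fin (m + 1 + 1))) X₁] [IsManifold (𝓡 (m + 1 + 1)) ∞ X₁]
    {X₂ : Type} [TopologicalSpace X₂] [T2Space X₂] [CompactSpace X₂]
    [ChartedSpace (EuclideanSpace ℝ (Fin (m + 1 + 1))) X₂] [IsManifold (𝓡 (m + 1 + 1)) ∞ X₂]
    {P : Type} [TopologicalSpace P] [T2Space P] [CompactSpace P]
    [ChartedSpace (EuclideanSpace ℝ (Fin (m + 1 + 1))) P] [IsManifold (𝓡 (m + 1 + 1)) ∞ P]
    (G₁ : BoundaryGluingData cM₁.boundaryData cN₁.boundaryData φ₁ X₁)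
    (G₂ : BoundaryGluingData cM₂.boundaryData cN₂.boundaryData φ₂ X₂)
    (G : BoundaryGluingData cM₁.boundaryData cM₂.boundaryData ψ P)
    [ConnectedSpace cM₁.W] [ConnectedSpace cM₂.W]
    {k : ℕ} (h : k + k = m + 1 + 1) (hk : Even k)
    (hN₁ : ∀ a b : singularCohomology ℤ ℤ (ClosedModel (m + 1) cN₁.W) k, cupProduct h a b = 0)
    (hN₂ : ∀ a b : singularCohomology ℤ ℤ (ClosedModel (m + 1) cN₂.W) k, cupProduct h a b = 0)
    (μ₁ : HomologicalOrientation ℤ X₁ (m + 1 + 1)) (μ₂ : HomologicalOrientation ℤ X₂ (m + 1 + 1))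
    (μ : HomologicalOrientation ℤ P (m + 1 + 1)) :
    ∃ (μ₁' : HomologicalOrientation ℤ X₁ (m + 1 + 1))
      (μ₂' : HomologicalOrientation ℤ X₂ (m + 1 + 1)),
      μ.signatureInDim h = μ₁'.signatureInDim h + μ₂'.signatureInDim h := by
  obtain ⟨ε₁, ε₂, hε₁, hε₂, hσ⟩ :=
    exists_signs_signatureInDim_fibreSum G₁ G₂ G h hk hN₁ hN₂ μ₁ μ₂ μ
  have hneg : ∀ {X : Type} [TopologicalSpace X] [T2Space X] [CompactSpace X]
      [ChartedSpace (EuclideanSpace ℝ (Fin (m + 1 + 1))) X]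
      (ν : HomologicalOrientation ℤ X (m + 1 + 1)),
      (-ν).signatureInDim h = -ν.signatureInDim h := fun ν => by
    rw [HomologicalOrientation.signatureInDim_def, signature_intersectionForm_neg_holds h ν,
      ← HomologicalOrientation.signatureInDim_def]
  rcases hε₁ with rfl | rfl <;> rcases hε₂ with rfl | rfl
  · exact ⟨μ₁, μ₂, by rw [hσ]; ring⟩
  · exact ⟨μ₁, -μ₂, by rw [hσ, hneg]; ring⟩
  · exact ⟨-μ₁, μ₂, by rw [hσ, hneg]; ring⟩
  · exact ⟨-μ₁, -μ₂, by rw [hσ, hneg, hneg]; ring⟩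

end BoundaryGluingData

/-! ### Dimension four -/

namespace BoundaryGluingData

/-- **Torus surgery / piece replacement in dimension four: `|σ(P')| = |σ(P)|`.**  For closed
smooth oriented `4`-manifolds `P = M ∪_φ N`, `P' = M ∪_φ' N'` glued from the same connected
compact piece `M` and pieces `N`, `N'` whose closed models have vanishing cup product
`H² × H² → H⁴` (torus surgery: `N = N' = T² × D²`; `(T² × D²)/(T³) ≅ (T² × ℝ²)⁺`), the
signatures agree up to sign for all orientations (Akhmedov–Park 2010, §2, §4: `e` and `σ` are
unchanged by the torus surgeries). [cite: AkhmedovPark2010, §2 and §4; Kirby1989, Ch. II §5, Thm. 5.3] -/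
theorem natAbs_signature_eq_of_cupProduct_eq_zero
    {S : Type} [TopologicalSpace S] [ChartedSpace (EuclideanSpace ℝ (Fin 3)) S]
    [IsManifold (𝓡 3) ∞ S] [CompactSpace S] [Nonempty S] [T2Space S]
    {S' : Type} [TopologicalSpace S'] [ChartedSpace (EuclideanSpace ℝ (Fin 3)) S']
    [IsManifold (𝓡 3) ∞ S'] [CompactSpace S'] [Nonempty S'] [T2Space S']
    {S'' : Type} [TopologicalSpace S''] [ChartedSpace (EuclideanSpace ℝ (Fin 3)) S'']
    [IsManifold (𝓡 3) ∞ S''] [CompactSpace S''] [Nonempty S''] [T2Space S'']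
    {cM : NullCobordism 3 S} {cN : NullCobordism 3 S'} {cN' : NullCobordism 3 S''}
    {φ : S ≃ S'} {φ' : S ≃ S''}
    {P : Type} [TopologicalSpace P] [T2Space P] [CompactSpace P]
    [ChartedSpace (EuclideanSpace ℝ (Fin 4)) P] [IsManifold (𝓡 4) ∞ P]
    {P' : Type} [TopologicalSpace P'] [T2Space P'] [CompactSpace P']
    [ChartedSpace (EuclideanSpace ℝ (Fin 4)) P'] [IsManifold (𝓡 4) ∞ P']
    (G : BoundaryGluingData cM.boundaryData cN.boundaryData φ P)
    (G' : BoundaryGluingData cM.boundaryData cN'.boundaryData φ' P') [ConnectedSpace cM.W]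
    (hN : ∀ a b : singularCohomology ℤ ℤ (ClosedModel 3 cN.W) 2,
      cupProduct two_add_two_eq_four a b = 0)
    (hN' : ∀ a b : singularCohomology ℤ ℤ (ClosedModel 3 cN'.W) 2,
      cupProduct two_add_two_eq_four a b = 0)
    (μ : HomologicalOrientation ℤ P 4) (μ' : HomologicalOrientation ℤ P' 4) :
    μ'.signature.natAbs = μ.signature.natAbs := by
  rw [← HomologicalOrientation.signatureInDim_two_add_two,
    ← HomologicalOrientation.signatureInDim_two_add_two]
  rcases G.signatureInDim_eq_or_eq_neg_of_cupProduct_eq_zero G' (show 2 + 2 = 2 + 1 + 1 by rfl)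
    (by norm_num) hN hN' μ μ' with h1 | h1
  · exact congrArg Int.natAbs h1
  · rw [show μ'.signatureInDim two_add_two_eq_four =
        μ'.signatureInDim (show 2 + 2 = 2 + 1 + 1 by rfl) from rfl, h1, Int.natAbs_neg]

/-- **Torus surgery / piece replacement in dimension four: some orientation of `P'` has
`σ(P') = σ(P, μ)`** (Akhmedov–Park 2010, §2: the Luttinger/torus-surgered `Y_n(m)` has the
signature `0` of `Σ₂ × Σ_n`; §4: the torus-surgered `Z'`, `Z''` have the signature `-1` of
`T⁴ # ℂℙ²bar`). [cite: AkhmedovPark2010, §2 and §4; Kirby1989, Ch. II §5, Thm. 5.3] -/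
theorem exists_signature_eq_of_cupProduct_eq_zero
    {S : Type} [TopologicalSpace S] [ChartedSpace (EuclideanSpace ℝ (Fin 3)) S]
    [IsManifold (𝓡 3) ∞ S] [CompactSpace S] [Nonempty S] [T2Space S]
    {S' : Type} [TopologicalSpace S'] [ChartedSpace (EuclideanSpace ℝ (Fin 3)) S']
    [IsManifold (𝓡 3) ∞ S'] [CompactSpace S'] [Nonempty S'] [T2Space S']
    {S'' : Type} [TopologicalSpace S''] [ChartedSpace (EuclideanSpace ℝ (Fin 3)) S'']
    [IsManifold (𝓡 3) ∞ S''] [CompactSpace S''] [Nonempty S''] [T2Space S'']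
    {cM : NullCobordism 3 S} {cN : NullCobordism 3 S'} {cN' : NullCobordism 3 S''}
    {φ : S ≃ S'} {φ' : S ≃ S''}
    {P : Type} [TopologicalSpace P] [T2Space P] [CompactSpace P]
    [ChartedSpace (EuclideanSpace ℝ (Fin 4)) P] [IsManifold (𝓡 4) ∞ P]
    {P' : Type} [TopologicalSpace P'] [T2Space P'] [CompactSpace P']
    [ChartedSpace (EuclideanSpace ℝ (Fin 4)) P'] [IsManifold (𝓡 4) ∞ P']
    (G : BoundaryGluingData cM.boundaryData cN.boundaryData φ P)
    (G' : BoundaryGluingData cM.boundaryData cN'.boundaryData φ' P') [ConnectedSpace cM.W]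
    (hN : ∀ a b : singularCohomology ℤ ℤ (ClosedModel 3 cN.W) 2,
      cupProduct two_add_two_eq_four a b = 0)
    (hN' : ∀ a b : singularCohomology ℤ ℤ (ClosedModel 3 cN'.W) 2,
      cupProduct two_add_two_eq_four a b = 0)
    (μ : HomologicalOrientation ℤ P 4) (μ' : HomologicalOrientation ℤ P' 4) :
    ∃ μ'' : HomologicalOrientation ℤ P' 4, μ''.signature = μ.signature := by
  obtain ⟨μ'', h⟩ := G.exists_signatureInDim_eq_of_cupProduct_eq_zero G'
    (show 2 + 2 = 2 + 1 + 1 by rfl) (by norm_num) hN hN' μ μ'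
  exact ⟨μ'', h⟩

/-- **The signature of a four-dimensional fibre sum is additive for suitable orientations**:
`Xᵢ = Mᵢ ∪ Nᵢ` closed smooth `4`-manifolds with `N̂ᵢ` cup-trivial in degree `2` (fibre sum along a
surface `Σ` of self-intersection `0`: `Nᵢ = Σ × D²`) and `Mᵢ` connected, `P = M₁ ∪_ψ M₂`: there are
orientations with `σ(P, μ) = σ(X₁, μ₁') + σ(X₂, μ₂')` (Gompf 1995, p. 535; Akhmedov–Park 2010,
proof of Lemma 8: "`σ(X₁(m)) = σ(Y₁(1,1)) + σ(Z''(1,m))`"). [cite: Gompf1995, p. 535; AkhmedovPark2010, §9 proof of Lemma 8] -/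
theorem exists_signature_fibreSum_eq_add
    {S₁ : Type} [TopologicalSpace S₁] [ChartedSpace (EuclideanSpace ℝ (Fin 3)) S₁]
    [IsManifold (𝓡 3) ∞ S₁] [CompactSpace S₁] [Nonempty S₁] [T2Space S₁]
    {S₁' : Type} [TopologicalSpace S₁'] [ChartedSpace (EuclideanSpace ℝ (Fin 3)) S₁']
    [IsManifold (𝓡 3) ∞ S₁'] [CompactSpace S₁'] [Nonempty S₁'] [T2Space S₁']
    {S₂ : Type} [TopologicalSpace S₂] [ChartedSpace (EuclideanSpace ℝ (Fin 3)) S₂]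
    [IsManifold (𝓡 3) ∞ S₂] [CompactSpace S₂] [Nonempty S₂] [T2Space S₂]
    {S₂' : Type} [TopologicalSpace S₂'] [ChartedSpace (EuclideanSpace ℝ (Fin 3)) S₂']
    [IsManifold (𝓡 3) ∞ S₂'] [CompactSpace S₂'] [Nonempty S₂'] [T2Space S₂']
    {cM₁ : NullCobordism 3 S₁} {cN₁ : NullCobordism 3 S₁'}
    {cM₂ : NullCobordism 3 S₂} {cN₂ : NullCobordism 3 S₂'}
    {φ₁ : S₁ ≃ S₁'} {φ₂ : S₂ ≃ S₂'} {ψ : S₁ ≃ S₂}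
    {X₁ : Type} [TopologicalSpace X₁] [T2Space X₁] [CompactSpace X₁]
    [ChartedSpace (EuclideanSpace ℝ (Fin 4)) X₁] [IsManifold (𝓡 4) ∞ X₁]
    {X₂ : Type} [TopologicalSpace X₂] [T2Space X₂] [CompactSpace X₂]
    [ChartedSpace (EuclideanSpace ℝ (Fin 4)) X₂] [IsManifold (𝓡 4) ∞ X₂]
    {P : Type} [TopologicalSpace P] [T2Space P] [CompactSpace P]
    [ChartedSpace (EuclideanSpace ℝ (Fin 4)) P] [IsManifold (𝓡 4) ∞ P]
    (G₁ : BoundaryGluingData cM₁.boundaryData cN₁.boundaryData φ₁ X₁)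
    (G₂ : BoundaryGluingData cM₂.boundaryData cN₂.boundaryData φ₂ X₂)
    (G : BoundaryGluingData cM₁.boundaryData cM₂.boundaryData ψ P)
    [ConnectedSpace cM₁.W] [ConnectedSpace cM₂.W]
    (hN₁ : ∀ a b : singularCohomology ℤ ℤ (ClosedModel 3 cN₁.W) 2,
      cupProduct two_add_two_eq_four a b = 0)
    (hN₂ : ∀ a b : singularCohomology ℤ ℤ (ClosedModel 3 cN₂.W) 2,
      cupProduct two_add_two_eq_four a b = 0)
    (μ₁ : HomologicalOrientation ℤ X₁ 4) (μ₂ : HomologicalOrientation ℤ X₂ 4)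
    (μ : HomologicalOrientation ℤ P 4) :
    ∃ (μ₁' : HomologicalOrientation ℤ X₁ 4) (μ₂' : HomologicalOrientation ℤ X₂ 4),
      μ.signature = μ₁'.signature + μ₂'.signature := by
  obtain ⟨μ₁', μ₂', h⟩ := exists_signatureInDim_fibreSum_eq_add G₁ G₂ G
    (show 2 + 2 = 2 + 1 + 1 by rfl) (by norm_num) hN₁ hN₂ μ₁ μ₂ μ
  exact ⟨μ₁', μ₂', h⟩

end BoundaryGluingData

end Literature.Topology.FourManifolds

end
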